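import Summits.ABC.StewartYu.PadicG3ParNBudgetE
import HarnessLib

/-!
# The `𝔑`-threaded odd-`p` record `PadicG3ParN` — file F: the HEADLINE AT EVERY `m` and the smallness line `U_floor_N`

Support file (theorems only; no named facts). Cell `abc-stewartyu`, route `YuMatveevShapeRat`, crux r3 `PadicCoreOddRat`
(stmt-ABC-20503); seat p1 (record owner). From file E's `m ≥ 1` letters and file D's `m = 0` headline:
`CondFloorN_le_of_m_pos`, `headline_N_pos`, **`headline_N : 2·(8·2ⁿ·Zp + CondFloorN n) ≤ (2^100)ⁿ·(p/log p)·Ω·Wp` (every `m`,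
`θ₀ = ½`, `n ≥ 2`, `Aⱼ ≥ 1`, `Amax ≤ 2ⁿΩ`, `N_q = K`, `K₀ = p − 1`)** — the `hhead` of p2's `recordSupplyOddSatRD_of_headline`
(`c_h = 2^100`, `4c_h ≤ 2^111 = CLine`) — and **`G3Setup.U_floor_N`** (`∃ U, ‖Λ/b_{j₀}‖ ≤ e^{−U} ∧ 8·2ⁿ·Zp + CondFloorN n ≤ U`
under the negated bound with `R ≥ (2^100)ⁿ·(p/log p)·Ω·Wp`).

## References
* [Yu2013] K. Yu, Acta Math. 211 (2013) — Theorem 1 (shape), §7.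
-/

noncomputable section

open Finset Real

namespace Summit.ABC.StewartYu

namespace PadicG3ParN

open PadicG3Par (Cb cM cG two_le_Cb Cb_pos sixteen_Cb_le log_Cb_le)

variable {n : ℕ} (P : PadicG3ParN n)

/-- `1 ≤ m`, … ⟹ **`CondFloorN n ≤ (n+1)²·2^{43n+82}·(p/log p)·Ω·Wp`**. [folklore] -/
theorem CondFloorN_le_of_m_pos (hm : 1 ≤ P.m) (hθ : P.θ₀ = 1 / 2) (hNq : P.Nq = P.K) (hA1 : ∀ j, 1 ≤ P.A j)
    (hAmaxΩ : P.Amax ≤ 2 ^ n * P.Ω) (hK₀ : (P.p : ℝ) - 1 ≤ P.K₀) :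
    P.CondFloorN n ≤ ((n : ℝ) + 1) ^ 2 * 2 ^ (43 * n + 82) * (P.p / Real.log P.p) * P.Ω * P.Wp := by
  have h1 := P.CondFloorN_le_Ω_mul hNq n
  have h2 := P.CondFloorV_le n
  have hX := P.XV_le_of_m_pos hm hθ hNq hA1 hAmaxΩ hK₀
  have hKl := P.K_log_le_of_m_pos hm hθ
  have hG := P.G_le_of_m_pos hm hθ
  have hGg := P.G_eq_mul_g
  have hg1 := P.one_le_g
  obtain ⟨hκ1, hκ0⟩ := P.kappa_le_one
  have hl := P.log_p_pos
  have hWp := P.one_le_Wp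
  have hΩ := P.Ω_pos
  have hKpos := P.K_pos
  have hn0 : (0 : ℝ) ≤ n := Nat.cast_nonneg n
  have hg4 : P.g ≤ 4 := by rw [hGg] at hG; nlinarith
  have hNqK : (P.Nq : ℝ) = P.K := by exact_mod_cast hNq
  -- `(2/log 2)ⁿ ≤ 2^{2n}`
  have h3 : (2 / Real.log 2) ^ n ≤ (2 : ℝ) ^ (2 * n) := by
    have hl2' : Real.log 2 > 0.6931471803 := Real.log_two_gt_d9
    have hle : (2 : ℝ) / Real.log 2 ≤ 4 := by rw [div_le_iff₀ (by linarith)]; linarith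
    calc (2 / Real.log 2) ^ n ≤ (4 : ℝ) ^ n := pow_le_pow_left₀ (by positivity) hle n
      _ = 2 ^ (2 * n) := by rw [pow_mul]; norm_num
  -- `CondFloorV n ≤ 2^{2n+27} K g² XV κ ≤ 2^{2n+27}·K·16·XV` (κ ≤ 1)
  rw [hNqK] at h2
  have h4 : P.CondFloorV n ≤ 2 ^ (n + n + 27) * P.K * 16 * P.XV := by
    have hg2 : P.g ^ 2 ≤ 16 := by nlinarith
    have h0 : 0 ≤ (2 : ℝ) ^ (n + n + 27) * P.K := by positivity
    have hX0 : (0 : ℝ) ≤ P.XV := by positivity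
    calc P.CondFloorV n ≤ 2 ^ (n + n + 27) * P.K * P.g ^ 2 * P.XV * (Real.log P.p / (P.p - 1)) := h2
      _ ≤ 2 ^ (n + n + 27) * P.K * P.g ^ 2 * P.XV * 1 := by
          apply mul_le_mul_of_nonneg_left hκ1; positivity
      _ ≤ 2 ^ (n + n + 27) * P.K * 16 * P.XV := by nlinarith [mul_le_mul_of_nonneg_left hg2 h0]
  -- multiply by `log p` and use `K log p ≤ (n+1)2^{36n+40} p`, `XV ≤ (n+1)2^{3n+10} Wp`
  have h5 : P.CondFloorN n * Real.log P.p ≤ ((n : ℝ) + 1) ^ 2 * 2 ^ (43 * n + 82) * P.p * P.Ω * P.Wp := by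
    have hC0 : 0 ≤ P.CondFloorV n := by
      unfold PadicG3Par.CondFloorV; have hg : 0 ≤ P.g := by linarith
      positivity
    have ha : P.CondFloorN n * Real.log P.p ≤ 2 * (2 ^ (2 * n) * P.Ω) * (2 ^ (n + n + 27) * P.K * 16 * P.XV) * Real.log P.p := by
      apply mul_le_mul_of_nonneg_right _ hl.le
      calc P.CondFloorN n ≤ 2 * ((2 / Real.log 2) ^ n * P.Ω) * P.CondFloorV n := h1
        _ ≤ 2 * (2 ^ (2 * n) * P.Ω) * P.CondFloorV n := by
            apply mul_le_mul_of_nonneg_right _ hC0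
            exact mul_le_mul_of_nonneg_left (mul_le_mul_of_nonneg_right h3 hΩ.le) (by norm_num)
        _ ≤ 2 * (2 ^ (2 * n) * P.Ω) * (2 ^ (n + n + 27) * P.K * 16 * P.XV) := mul_le_mul_of_nonneg_left h4 (by positivity)
    have e : 2 * (2 ^ (2 * n) * P.Ω) * (2 ^ (n + n + 27) * P.K * 16 * P.XV) * Real.log P.p =
        2 ^ (4 * n + 32) * P.Ω * P.XV * (P.K * Real.log P.p) := by
      have : (2 : ℝ) ^ (4 * n + 32) = 2 * 16 * 2 ^ (2 * n) * 2 ^ (n + n + 27) := by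
        rw [show (2 : ℝ) * 16 = 2 ^ 5 by norm_num, ← pow_add, ← pow_add]; ring_nf
      rw [this]; ring
    rw [e] at ha
    have hb : 2 ^ (4 * n + 32) * P.Ω * P.XV * (P.K * Real.log P.p) ≤
        2 ^ (4 * n + 32) * P.Ω * (((n : ℝ) + 1) * 2 ^ (3 * n + 10) * P.Wp) * (((n : ℝ) + 1) * 2 ^ (36 * n + 40) * P.p) := by
      have h00 : 0 ≤ (2 : ℝ) ^ (4 * n + 32) * P.Ω := by positivity
      have := mul_le_mul hX hKl (by positivity) (by positivity)
      nlinarith [mul_le_mul_of_nonneg_left this h00]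
    have e2 : 2 ^ (4 * n + 32) * P.Ω * (((n : ℝ) + 1) * 2 ^ (3 * n + 10) * P.Wp) * (((n : ℝ) + 1) * 2 ^ (36 * n + 40) * P.p) =
        ((n : ℝ) + 1) ^ 2 * 2 ^ (43 * n + 82) * P.p * P.Ω * P.Wp := by
      have : (2 : ℝ) ^ (43 * n + 82) = 2 ^ (4 * n + 32) * 2 ^ (3 * n + 10) * 2 ^ (36 * n + 40) := by
        rw [← pow_add, ← pow_add]; ring_nf
      rw [this]; ring
    linarith
  have e3 : ((n : ℝ) + 1) ^ 2 * 2 ^ (43 * n + 82) * (P.p / Real.log P.p) * P.Ω * P.Wp =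
      ((n : ℝ) + 1) ^ 2 * 2 ^ (43 * n + 82) * P.p * P.Ω * P.Wp / Real.log P.p := by field_simp
  rw [e3, le_div_iff₀ hl]
  exact h5

/-- **THE `m ≥ 1` HEADLINE of the N-record (`n ≥ 2`): `2·(8·2ⁿ·Zp + CondFloorN n) ≤ (2^100)ⁿ·(p/log p)·Ω·Wp`.**
[cite: Yu2013, Theorem 1 (shape)] -/
theorem headline_N_pos (hm : 1 ≤ P.m) (hθ : P.θ₀ = 1 / 2) (hn2 : 2 ≤ n) (hNq : P.Nq = P.K) (hA1 : ∀ j, 1 ≤ P.A j)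
    (hAmaxΩ : P.Amax ≤ 2 ^ n * P.Ω) (hK₀ : (P.p : ℝ) - 1 ≤ P.K₀) :
    2 * (8 * 2 ^ n * P.Zp + P.CondFloorN n) ≤ ((2 : ℝ) ^ 100) ^ n * (P.p / Real.log P.p) * P.Ω * P.Wp := by
  have h1 := P.main_term_le_of_m_pos hm hθ hNq hA1 hAmaxΩ hK₀
  have h2 := P.CondFloorN_le_of_m_pos hm hθ hNq hA1 hAmaxΩ hK₀
  have hl := P.log_p_pos
  have hΩ := P.Ω_pos
  have hWp := P.one_le_Wp
  have hp0 : (0 : ℝ) < P.p := by linarith [P.two_le_p]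
  have hB0 : 0 ≤ (P.p : ℝ) / Real.log P.p * P.Ω * P.Wp := by positivity
  -- `(n+1)³ ≤ 2^{3n}`, `C_bⁿ ≤ 2^{7n}`
  have hn1 : ((n : ℝ) + 1) ≤ 2 ^ n := by exact_mod_cast Nat.succ_le_of_lt n.lt_two_pow_self
  have hn3 : ((n : ℝ) + 1) ^ 3 ≤ 2 ^ (3 * n) := by
    calc ((n : ℝ) + 1) ^ 3 ≤ (2 ^ n) ^ 3 := pow_le_pow_left₀ (by positivity) hn1 3
      _ = 2 ^ (3 * n) := by rw [← pow_mul]; ring_nf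
  have hn2' : ((n : ℝ) + 1) ^ 2 ≤ 2 ^ (2 * n) := by
    calc ((n : ℝ) + 1) ^ 2 ≤ (2 ^ n) ^ 2 := pow_le_pow_left₀ (by positivity) hn1 2
      _ = 2 ^ (2 * n) := by rw [← pow_mul]; ring_nf
  have hCb : Cb ^ n ≤ (2 : ℝ) ^ (7 * n) := by
    have h : Cb ≤ (2 : ℝ) ^ 7 := by have := sixteen_Cb_le; nlinarith [Cb_pos]
    calc Cb ^ n ≤ ((2 : ℝ) ^ 7) ^ n := pow_le_pow_left₀ Cb_pos.le h n
      _ = 2 ^ (7 * n) := by rw [← pow_mul]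
  have hA : ((n : ℝ) + 1) ^ 3 * Cb ^ n * 2 ^ (41 * n + 70) ≤ 2 ^ (51 * n + 70) := by
    have e : (2 : ℝ) ^ (51 * n + 70) = 2 ^ (3 * n) * 2 ^ (7 * n) * 2 ^ (41 * n + 70) := by
      rw [← pow_add, ← pow_add]; ring_nf
    rw [e]
    exact mul_le_mul_of_nonneg_right (mul_le_mul hn3 hCb (pow_nonneg Cb_pos.le n) (by positivity)) (by positivity)
  have hB : ((n : ℝ) + 1) ^ 2 * 2 ^ (43 * n + 82) ≤ 2 ^ (51 * n + 82) := by
    have e : (2 : ℝ) ^ (51 * n + 82) = 2 ^ (2 * n) * 2 ^ (6 * n) * 2 ^ (43 * n + 82) := by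
      rw [← pow_add, ← pow_add]; ring_nf
    rw [e]
    have h6 : (1 : ℝ) ≤ 2 ^ (6 * n) := one_le_pow₀ (by norm_num)
    calc ((n : ℝ) + 1) ^ 2 * 2 ^ (43 * n + 82) = ((n : ℝ) + 1) ^ 2 * 1 * 2 ^ (43 * n + 82) := by ring
      _ ≤ 2 ^ (2 * n) * 2 ^ (6 * n) * 2 ^ (43 * n + 82) :=
          mul_le_mul_of_nonneg_right (mul_le_mul hn2' h6 (by norm_num) (by positivity)) (by positivity)
  have hsum : 2 * ((2 : ℝ) ^ (51 * n + 70) + 2 ^ (51 * n + 82)) ≤ ((2 : ℝ) ^ 100) ^ n := by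
    rw [← pow_mul]
    have e1 : (2 : ℝ) ^ (51 * n + 70) ≤ 2 ^ (51 * n + 82) := pow_le_pow_right₀ (by norm_num) (by omega)
    have e2 : (2 : ℝ) * (2 ^ (51 * n + 82) + 2 ^ (51 * n + 82)) = 2 ^ (51 * n + 84) := by
      rw [show 51 * n + 84 = (51 * n + 82) + 2 by omega, pow_add]; ring
    have e3 : (2 : ℝ) ^ (51 * n + 84) ≤ 2 ^ (100 * n) := pow_le_pow_right₀ (by norm_num) (by omega)
    linarith
  calc 2 * (8 * 2 ^ n * P.Zp + P.CondFloorN n)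
      ≤ 2 * (((n : ℝ) + 1) ^ 3 * Cb ^ n * 2 ^ (41 * n + 70) * ((P.p / Real.log P.p) * P.Ω * P.Wp) +
          ((n : ℝ) + 1) ^ 2 * 2 ^ (43 * n + 82) * ((P.p / Real.log P.p) * P.Ω * P.Wp)) := by linarith
    _ ≤ 2 * (2 ^ (51 * n + 70) * ((P.p / Real.log P.p) * P.Ω * P.Wp) + 2 ^ (51 * n + 82) * ((P.p / Real.log P.p) * P.Ω * P.Wp)) := by
        gcongr
    _ = 2 * ((2 : ℝ) ^ (51 * n + 70) + 2 ^ (51 * n + 82)) * ((P.p / Real.log P.p) * P.Ω * P.Wp) := by ring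
    _ ≤ ((2 : ℝ) ^ 100) ^ n * ((P.p / Real.log P.p) * P.Ω * P.Wp) := mul_le_mul_of_nonneg_right hsum hB0
    _ = _ := by ring

/-- **THE HEADLINE OF THE N-RECORD AT EVERY `m`** (`θ₀ = ½`, `n ≥ 2`, `Aⱼ ≥ 1`, `Amax ≤ 2ⁿΩ`, `N_q = K`, `K₀ = p − 1`):
`2·(8·2ⁿ·Zp + CondFloorN n) ≤ (2^100)ⁿ·(p/log p)·Ω·Wp`. [cite: Yu2013, Theorem 1 (shape)] -/
theorem headline_N (hθ : P.θ₀ = 1 / 2) (hn2 : 2 ≤ n) (hNq : P.Nq = P.K) (hA1 : ∀ j, 1 ≤ P.A j)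
    (hAmaxΩ : P.Amax ≤ 2 ^ n * P.Ω) (hK₀ : (P.K₀ : ℝ) = P.p - 1) :
    2 * (8 * 2 ^ n * P.Zp + P.CondFloorN n) ≤ ((2 : ℝ) ^ 100) ^ n * (P.p / Real.log P.p) * P.Ω * P.Wp := by
  rcases Nat.eq_zero_or_pos P.m with hm | hm
  · exact P.headline_N_zero hm hθ hn2 hA1 hAmaxΩ hNq hK₀
  · exact P.headline_N_pos hm hθ hn2 hNq hA1 hAmaxΩ hK₀.ge

end PadicG3ParN

namespace G3Setup

variable {p : ℕ} [Fact p.Prime] (S : G3Setup p)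

/-- **THE SMALLNESS LINE OF THE N-RECORD AT EVERY `m`**: under the negated bound `¬ ord_p(∏αⱼ^{bⱼ} − 1)·log p ≤ R` with
`(2^100)ⁿ·(p/log p)·Ω·Wp ≤ R` and the budget letter `log max(3,|bⱼ|) ≤ P.W` (`θ₀ = ½`, `n ≥ 2`, `Aⱼ ≥ 1`, `Amax ≤ 2ⁿΩ`,
`N_q = K`, `K₀ = p − 1`): `∃ U, ‖Λ/b_{j₀}‖_p ≤ e^{−U} ∧ 8·2ⁿ·Zp + CondFloorN n ≤ U`. [cite: Yu2013, §7; shape only] -/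
theorem U_floor_N (P : PadicG3ParN S.n) (hPp : P.p = p) (hθ : P.θ₀ = 1 / 2) (hn2 : 2 ≤ S.n) (hNq : P.Nq = P.K)
    (hA1 : ∀ j, 1 ≤ P.A j) (hAmaxΩ : P.Amax ≤ 2 ^ S.n * P.Ω) (hK₀ : (P.K₀ : ℝ) = P.p - 1)
    (hWb : ∀ j, Real.log (max 3 (|S.b j| : ℝ)) ≤ P.W) {R : ℝ}
    (hU : ¬ (padicValRat p (∏ j, S.α j ^ S.b j - 1) : ℝ) * Real.log p ≤ R)
    (hR : ((2 : ℝ) ^ 100) ^ S.n * ((P.p : ℝ) / Real.log P.p) * P.Ω * P.Wp ≤ R) :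
    ∃ U : ℝ, ‖S.Λ / (S.b S.j₀ : ℚ_[p])‖ ≤ Real.exp (-U) ∧ 8 * 2 ^ S.n * P.Zp + P.CondFloorN S.n ≤ U :=
  S.U_floor_of_headline P hPp (by rw [hθ]) hWb hU ((P.headline_N hθ hn2 hNq hA1 hAmaxΩ hK₀).trans hR)

end G3Setup

end Summit.ABC.StewartYu
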